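import Summits.KontsevichZagierPeriods.KontsevichZagierPeriods.Theorems.HurwitzMicroSectorsNormalFormPrincipleLevelOneTowerCarriers

/-!
# `NormalFormPrinciple` (stmt-KontsevichZagierPeriods-3869), line `SketchIdeator1` — the level-one box
# tower, II: the REDUCTION to the normal form `Σ_{2≤j≤w} [(0,1)ʲ, β_j/(1 − ∏x)] + [pt, q]`

Pure proof file (`--supports` the crux; registered sub-goal `tower_reduce`).
The LEVEL-ONE BOX TOWER of the leaf `stub_boxRigidity` (lead seat c7, cycle 9 of crux
stmt-KontsevichZagierPeriods-3869, line `SketchIdeator1`): all representations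
`[(0,1)ʷ, P(x)/(1 − x₀⋯x_{w−1})]`, `P ∈ ℚ[x₀,…,x_{w−1}]`, `w ≥ 2` — the natural completion of the route's
diagonal Hurwitz rungs and of Beukers' integrals `∫_{(0,1)ʷ} dx/(1 − ∏xᵢ) = ζ(w)`; values
`Σ_{j=2}^{w} c_j ζ(j) + c₀` (off-diagonal monomials have values in the span of lower weights, e.g.
`∫∫∫ z/(1−xyz) = ζ(2) − 1`). Engine (card `merge-gadget-join-rung` of the crux): the MERGE GADGET with
spectators — the substitution `z_last = y·x_last` along the last coordinate (rule 2,
`merge_box_sub_band_dim`) followed by one Newton–Leibniz move along `y` (rule 3, `band_sub_levelOne_dim`)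
— sends a monomial whose last two exponents differ to a member of the tower ONE DIMENSION DOWN; a
coordinate permutation (rule 2) arranges that for every non-constant exponent vector; a constant exponent
vector is diagonal, `c(∏x)^a/(1 − ∏x) = c/(1 − ∏x) − c Σ_{i<a} (∏x)^i` (rule 1b), and polynomial boxes
collapse to rational points (`boxPoly_exists_pt`). Normal form: `Σ_{j=2}^{w} [(0,1)ʲ, β_j/(1 − ∏x)] + [pt, q]`.
Sources: M. Kontsevich, D. Zagier, *Periods* (2001), §1.1–1.2; F. Beukers, Bull. LMS 11 (1979).
No definitions are introduced.

This file: `offDiag_descend` (one dimension down through the band representation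
`exists_bandRep_dim`), `diag_exists_pt_dim`, and `tower_reduce` by induction on the dimension (base:
`levelOne_reduce` of the dimension-two layer), with the value formula `tower_value` and the monotonicity
of normal forms in the height.
-/

noncomputable section

open MeasureTheory Set
open scoped Polynomial
open Literature.NumberTheory.Transcendental Literature.NumberTheory.Transcendental.KZ
open Literature.ModelTheory.ExponentialFields (IsSemialgebraic)

namespace Summit.KontsevichZagierPeriods.HurwitzMicroSectors.NormalFormPrinciple.PiBox.LevelOne

open Summit.KontsevichZagierPeriods.HurwitzMicroSectors.NormalFormPrinciple.PiBox.Dlog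
  (exists_ptCarrier value_pt pt_add_mem_relations pt_zero_mem_relations pt_congr_mem_relations)

/-! ## Composition (lead), part II: the reduction of the tower -/

/-! ### Evaluation of monomials -/

/-- Evaluation of a monomial of `ℚ[x₀,…,x_{n−1}]` at a real point. [folklore] -/
theorem aeval_monomial_dim {n : ℕ} (s : Fin n →₀ ℕ) (c : ℚ) (x : Fin n → ℝ) :
    (MvPolynomial.aeval x (MvPolynomial.monomial s c) : ℝ) = (c : ℝ) * ∏ i, x i ^ s i := by
  rw [MvPolynomial.aeval_monomial, Finsupp.prod_fintype _ _ (fun i => by simp)]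
  simp

/-- Splitting off the last two coordinates of a product over `Fin (w + 2)`. [folklore] -/
theorem prod_univ_init_init {w : ℕ} (z : Fin (w + 2) → ℝ) (t : Fin (w + 2) → ℕ) :
    ∏ i, z i ^ t i = (∏ i : Fin w, Fin.init (Fin.init z) i ^ t (Fin.castSucc (Fin.castSucc i))) *
      (z (Fin.castSucc (Fin.last w)) ^ t (Fin.castSucc (Fin.last w)) *
        z (Fin.last (w + 1)) ^ t (Fin.last (w + 1))) := by
  rw [Fin.prod_univ_castSucc, Fin.prod_univ_castSucc]
  simp only [Fin.init]
  ring

/-- The numerator polynomial left by the merge gadget, evaluated. [folklore] -/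
theorem aeval_mergePoly_dim {w : ℕ} (e : Fin w → ℕ) (a b : ℕ) (c : ℚ) (x : Fin (w + 1) → ℝ) :
    (MvPolynomial.aeval x (MvPolynomial.C (c / ((a - b : ℕ) : ℚ)) *
      ((∏ i : Fin w, MvPolynomial.X (Fin.castSucc i) ^ e i) *
        (MvPolynomial.X (Fin.last w) ^ b * (1 - MvPolynomial.X (Fin.last w) ^ (a - b)))) :
        MvPolynomial (Fin (w + 1)) ℚ) : ℝ) =
      (c : ℝ) / ((a - b : ℕ) : ℝ) *
        ((∏ i, Fin.init x i ^ e i) * (x (Fin.last w) ^ b * (1 - x (Fin.last w) ^ (a - b)))) := by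
  simp [map_prod, Fin.init]

/-! ### Off-diagonal monomials drop one dimension -/

/-- **An off-diagonal monomial of the tower whose last two exponents satisfy `a > b` is congruent to a
member of the tower one dimension down** (merge gadget `merge_box_sub_band_dim`, Newton–Leibniz
`band_sub_levelOne_dim`). [cite: KontsevichZagier2001, §1.2] -/
theorem offDiag_descend_of_lt {w : ℕ} (e : Fin w → ℕ) (a b : ℕ) (c : ℚ) (hab : b < a)
    (N : IntegralRep (w + 2)) (hNd : N.domain = {x | ∀ i, x i ∈ Set.Ioo (0:ℝ) 1})
    (hNi : EqOn N.integrand (fun z => (c : ℝ) * ((∏ i, Fin.init (Fin.init z) i ^ e i) *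
        (z (Fin.castSucc (Fin.last w)) ^ a * z (Fin.last (w + 1)) ^ b)) / (1 - ∏ i, z i)) N.domain) :
    ∃ (P₁ : MvPolynomial (Fin (w + 1)) ℚ) (N₁ : IntegralRep (w + 1)),
      N₁.domain = {x | ∀ i, x i ∈ Set.Ioo (0:ℝ) 1} ∧
      EqOn N₁.integrand (fun x => (MvPolynomial.aeval x P₁ : ℝ) / (1 - ∏ i, x i)) N₁.domain ∧
      of N - of N₁ ∈ relations := by
  obtain ⟨R, hRd, hRi⟩ := exists_bandRep_dim e a b c hab
  have h1 := merge_box_sub_band_dim e a b c hab N R hNd hNi hRd (by rw [hRi]; exact fun _ _ => rfl)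
  set P₁ : MvPolynomial (Fin (w + 1)) ℚ := MvPolynomial.C (c / ((a - b : ℕ) : ℚ)) *
      ((∏ i : Fin w, MvPolynomial.X (Fin.castSucc i) ^ e i) *
        (MvPolynomial.X (Fin.last w) ^ b * (1 - MvPolynomial.X (Fin.last w) ^ (a - b)))) with hP₁
  -- the target representation: a tower member in dimension `w + 1 ≥ 2`, or a polynomial box if `w = 0`
  have hex : ∃ N₁ : IntegralRep (w + 1), N₁.domain = {x | ∀ i, x i ∈ Set.Ioo (0:ℝ) 1} ∧
      EqOn N₁.integrand (fun x => (MvPolynomial.aeval x P₁ : ℝ) / (1 - ∏ i, x i)) N₁.domain := by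
    rcases Nat.eq_zero_or_pos w with rfl | hw
    · -- `w = 0`: the quotient is a polynomial on `(0,1)`
      set Q : MvPolynomial (Fin 1) ℚ := MvPolynomial.C (c / ((a - b : ℕ) : ℚ)) *
        (MvPolynomial.X (Fin.last 0) ^ b * ∑ i ∈ Finset.range (a - b), MvPolynomial.X (Fin.last 0) ^ i)
        with hQ
      obtain ⟨N₁, hN₁d, hN₁i⟩ := exists_boxPolyRep Q
      refine ⟨N₁, hN₁d, fun x hx => ?_⟩
      rw [hN₁i hx, hQ, hP₁]
      have hx1 : x (Fin.last 0) ∈ Set.Ioo (0:ℝ) 1 := by rw [hN₁d] at hx; exact hx _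
      have ht : 1 - x (Fin.last 0) ≠ 0 := by linarith [hx1.2]
      have hl : (Fin.last 0 : Fin (0 + 1)) = 0 := rfl
      simp only [map_mul, MvPolynomial.aeval_C, map_pow, MvPolynomial.aeval_X, map_sum, map_sub,
        map_one, eq_ratCast, Finset.univ_eq_empty, Finset.prod_empty, one_mul, hl,
        Fin.prod_univ_succ, mul_one]
      have ht0 : 1 - x 0 ≠ 0 := ht
      have key := mul_neg_geom_sum (x 0) (a - b)
      rw [eq_div_iff ht0, ← key]
      push_cast
      ring
    · obtain ⟨N₁, hN₁d, hN₁i⟩ := exists_levelOneRep_dim (by omega : 2 ≤ w + 1) P₁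
      exact ⟨N₁, hN₁d, by rw [hN₁i]; exact fun _ _ => rfl⟩
  obtain ⟨N₁, hN₁d, hN₁i⟩ := hex
  have h2 := band_sub_levelOne_dim e a b c hab R N₁ hRd (by rw [hRi]; exact fun _ _ => rfl) hN₁d
    (fun x hx => by rw [hN₁i hx]; simp only [hP₁, aeval_mergePoly_dim])
  refine ⟨P₁, N₁, hN₁d, hN₁i, ?_⟩
  have e' : of N - of N₁ = (of N - of R) + (of R - of N₁) := by abel
  rw [e']
  exact relations.add_mem h1 h2

/-- **Every off-diagonal monomial of the tower drops one dimension**: if the exponent vector `s` of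
`[(0,1)^{w+2}, c x^s/(1 − ∏x)]` is not constant, a coordinate permutation (rule 2) brings two unequal
exponents to the last two places and `offDiag_descend_of_lt` applies. [cite: KontsevichZagier2001, §1.2] -/
theorem offDiag_descend {w : ℕ} (s : Fin (w + 2) → ℕ) (c : ℚ) {i j : Fin (w + 2)} (hij : s j < s i)
    (N : IntegralRep (w + 2)) (hNd : N.domain = {x | ∀ i, x i ∈ Set.Ioo (0:ℝ) 1})
    (hNi : EqOn N.integrand (fun x => (c : ℝ) * (∏ i, x i ^ s i) / (1 - ∏ i, x i)) N.domain) :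
    ∃ (P₁ : MvPolynomial (Fin (w + 1)) ℚ) (N₁ : IntegralRep (w + 1)),
      N₁.domain = {x | ∀ i, x i ∈ Set.Ioo (0:ℝ) 1} ∧
      EqOn N₁.integrand (fun x => (MvPolynomial.aeval x P₁ : ℝ) / (1 - ∏ i, x i)) N₁.domain ∧
      of N - of N₁ ∈ relations := by
  have hne : i ≠ j := fun h => by rw [h] at hij; exact lt_irrefl _ hij
  -- a coordinate permutation sending `i ↦ castSucc (last w)` and `j ↦ last (w+1)` (two transpositions;
  -- cf. `Literature.Probability.LatticeModels.exists_perm_apply_eq`)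
  have hperm : ∃ σ : Equiv.Perm (Fin (w + 2)), σ i = Fin.castSucc (Fin.last w) ∧ σ j = Fin.last (w + 1) := by
    have hpq : Fin.castSucc (Fin.last w) ≠ Fin.last (w + 1) := ne_of_lt (Fin.castSucc_lt_last _)
    set j' := Equiv.swap i (Fin.castSucc (Fin.last w)) j with hj'
    have hj'p : j' ≠ Fin.castSucc (Fin.last w) := by
      intro h
      rw [hj'] at h
      by_cases hjp : j = Fin.castSucc (Fin.last w)
      · rw [hjp, Equiv.swap_apply_right] at h
        exact hne (h.trans hjp.symm)
      · rw [Equiv.swap_apply_of_ne_of_ne hne.symm hjp] at h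
        exact hjp h
    refine ⟨(Equiv.swap i (Fin.castSucc (Fin.last w))).trans (Equiv.swap j' (Fin.last (w + 1))), ?_, ?_⟩
    · rw [Equiv.trans_apply, Equiv.swap_apply_left, Equiv.swap_apply_of_ne_of_ne hj'p.symm hpq]
    · rw [Equiv.trans_apply, ← hj', Equiv.swap_apply_left]
  obtain ⟨σ, hσi, hσj⟩ := hperm
  obtain ⟨hσd, hσint⟩ := reindex_monomial σ s c N hNd hNi
  have hrel := of_sub_of_reindex_mem_relations N σ
  -- exponents after the permutation
  have ha : s (σ.symm (Fin.castSucc (Fin.last w))) = s i := by rw [← hσi, Equiv.symm_apply_apply]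
  have hb : s (σ.symm (Fin.last (w + 1))) = s j := by rw [← hσj, Equiv.symm_apply_apply]
  obtain ⟨P₁, N₁, hN₁d, hN₁i, h⟩ := offDiag_descend_of_lt
    (fun l => s (σ.symm (Fin.castSucc (Fin.castSucc l)))) (s i) (s j) c hij (N.reindex σ) hσd
    (fun z hz => by
      rw [hσint hz]
      dsimp only
      rw [prod_univ_init_init z (fun m => s (σ.symm m)), ha, hb])
  refine ⟨P₁, N₁, hN₁d, hN₁i, ?_⟩
  have e' : of N - of N₁ = (of N - of (N.reindex σ)) + (of (N.reindex σ) - of N₁) := by abel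
  rw [e']
  exact relations.add_mem hrel h

/-! ### Diagonal monomials -/

/-- **A diagonal monomial `c (∏x)^a/(1 − ∏x)` is the carrier `c/(1 − ∏x)` plus a polynomial box, hence
`[B] + [pt, q]` modulo relations.** [cite: KontsevichZagier2001, §1.2] -/
theorem diag_exists_pt_dim {n : ℕ} (hn : n ≠ 0) (a : ℕ) (c : ℚ) (N : IntegralRep n)
    (hNd : N.domain = {x | ∀ i, x i ∈ Set.Ioo (0:ℝ) 1})
    (hNi : EqOn N.integrand (fun x => (c : ℝ) * (∏ i, x i) ^ a / (1 - ∏ i, x i)) N.domain) :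
    ∃ q : ℚ, ∀ (B : IntegralRep n) (Z : IntegralRep 0),
      B.domain = {x | ∀ i, x i ∈ Set.Ioo (0:ℝ) 1} →
      EqOn B.integrand (fun x => (c : ℝ) / (1 - ∏ i, x i)) B.domain →
      Z.domain = Set.univ → (Z.integrand = fun _ => (q : ℝ)) →
      of N - of B - of Z ∈ relations := by
  set pQ : MvPolynomial (Fin n) ℚ :=
    -(MvPolynomial.C c * ∑ i ∈ Finset.range a, (∏ i, MvPolynomial.X i) ^ i) with hpQ
  obtain ⟨Q, hQd, hQi⟩ := exists_boxPolyRep pQ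
  obtain ⟨q, hq⟩ := boxPoly_exists_pt pQ Q hQd hQi
  refine ⟨q, fun B Z hBd hBi hZd hZi => ?_⟩
  have hadd : of N - of B - of Q ∈ relations := by
    refine integrandAddRel_subset_relations ⟨n, N, B, Q, hBd.trans hNd.symm, hQd.trans hNd.symm,
      fun x hx => ?_, rfl⟩
    have hxB : x ∈ B.domain := by rw [hBd, ← hNd]; exact hx
    have hxQ : x ∈ Q.domain := by rw [hQd, ← hNd]; exact hx
    rw [Pi.add_apply, hNi hx, hBi hxB, hQi hxQ, hpQ]
    have hx' : ∀ i, x i ∈ Set.Ioo (0:ℝ) 1 := by rw [hNd] at hx; exact hx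
    have ht : 1 - ∏ i, x i ≠ 0 := by
      have hlt : ∏ i, x i < 1 := by
        calc ∏ i, x i < ∏ _i : Fin n, (1:ℝ) :=
              Finset.prod_lt_prod_of_nonempty (fun i _ => (hx' i).1) (fun i _ => (hx' i).2)
                ⟨⟨0, Nat.pos_of_ne_zero hn⟩, Finset.mem_univ _⟩
          _ = 1 := by simp
      linarith
    simp only [map_neg, map_mul, MvPolynomial.aeval_C, map_sum, map_pow, map_prod,
      MvPolynomial.aeval_X, eq_ratCast]
    exact diag_identity c (∏ i, x i) a ht
  have e' : of N - of B - of Z = (of N - of B - of Q) + (of Q - of Z) := by abel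
  rw [e']
  exact relations.add_mem hadd (hq Z hZd hZi)

/-! ## Composition (lead), part III: the tower normal form `Σ_{2≤j≤d} [(0,1)ʲ, β_j/(1 − ∏x)] + [pt, q]` -/

/-- **Reduction of the level-one box tower to its normal form.** Every representation
`[(0,1)^{k+2}, P(x)/(1 − x₀⋯x_{k+1})]`, `P ∈ ℚ[x₀,…,x_{k+1}]`, is congruent modulo Kontsevich–Zagier
relations to `Σ_{j=2}^{k+2} [(0,1)ʲ, β_j/(1 − ∏xᵢ)] + [pt, q]` for some rational `β_j` (`β_j = 0` for
`j > k + 2`) and `q`. Induction on the dimension: in dimension two this is `levelOne_reduce`; a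
monomial with constant exponent vector is diagonal (`diag_exists_pt_dim`), any other monomial drops
one dimension inside the tower (`offDiag_descend`), sums by integrand additivity.
[cite: KontsevichZagier2001, §1.2] -/
theorem tower_reduce : ∀ (k : ℕ) (P : MvPolynomial (Fin (k + 2)) ℚ) (N : IntegralRep (k + 2)),
    N.domain = {x | ∀ i, x i ∈ Set.Ioo (0:ℝ) 1} →
    EqOn N.integrand (fun x => (MvPolynomial.aeval x P : ℝ) / (1 - ∏ i, x i)) N.domain →
    ∃ (β : ℕ → ℚ) (q : ℚ), (∀ j, k + 2 < j → β j = 0) ∧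
      ∀ (B : (j : ℕ) → IntegralRep j) (Z : IntegralRep 0),
        (∀ j ∈ Finset.Icc 2 (k + 2), (B j).domain = {x | ∀ i, x i ∈ Set.Ioo (0:ℝ) 1} ∧
          EqOn (B j).integrand (fun x => (β j : ℝ) / (1 - ∏ i, x i)) (B j).domain) →
        Z.domain = Set.univ → (Z.integrand = fun _ => (q : ℝ)) →
        of N - (∑ j ∈ Finset.Icc 2 (k + 2), of (B j)) - of Z ∈ relations := by
  intro k
  induction k with
  | zero =>
    intro P N hNd hNi
    have hNi' : EqOn N.integrand (fun x => (MvPolynomial.aeval x P : ℝ) / (1 - x 0 * x 1)) N.domain :=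
      fun x hx => by rw [hNi hx]; simp [Fin.prod_univ_two]
    obtain ⟨β₂, q, h⟩ := levelOne_reduce P N hNd hNi'
    refine ⟨fun j => if j = 2 then β₂ else 0, q, fun j hj => if_neg (by omega),
      fun B Z hB hZd hZi => ?_⟩
    have h2 : (2:ℕ) ∈ Finset.Icc 2 (0 + 2) := by simp
    have hs := sum_carriers_single h2 B hB (fun j _ hne => if_neg hne)
    have e₁ := h (B 2) Z (hB 2 h2).1 (fun x hx => by
      rw [(hB 2 h2).2 hx]; simp [Fin.prod_univ_two]) hZd hZi
    have e : of N - (∑ j ∈ Finset.Icc 2 (0 + 2), of (B j)) - of Z =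
        (of N - of (B 2) - of Z) - ((∑ j ∈ Finset.Icc 2 (0 + 2), of (B j)) - of (B 2)) := by abel
    rw [e]
    exact relations.sub_mem e₁ hs
  | succ k ih =>
    intro P
    induction P using MvPolynomial.induction_on' with
    | monomial s c =>
      intro N hNd hNi
      have hNi' : EqOn N.integrand (fun x => (c : ℝ) * (∏ i, x i ^ s i) / (1 - ∏ i, x i)) N.domain :=
        fun x hx => by rw [hNi hx]; simp only [aeval_monomial_dim]
      by_cases hconst : ∀ i, s i = s 0
      · -- diagonal monomial
        have hNi'' : EqOn N.integrand (fun x => (c : ℝ) * (∏ i, x i) ^ (s 0) / (1 - ∏ i, x i))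
            N.domain := fun x hx => by
          rw [hNi' hx]
          simp only [hconst, Finset.prod_pow]
        obtain ⟨q, hq⟩ := diag_exists_pt_dim (by omega) (s 0) c N hNd hNi''
        refine ⟨fun j => if j = k + 1 + 2 then c else 0, q, fun j hj => if_neg (by omega),
          fun B Z hB hZd hZi => ?_⟩
        have htop : k + 1 + 2 ∈ Finset.Icc 2 (k + 1 + 2) := by simp
        have hs := sum_carriers_single htop B hB (fun j _ hne => if_neg hne)
        have e₁ := hq (B (k + 1 + 2)) Z (hB _ htop).1 (fun x hx => by
          rw [(hB _ htop).2 hx]; simp) hZd hZi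
        have e : of N - (∑ j ∈ Finset.Icc 2 (k + 1 + 2), of (B j)) - of Z =
            (of N - of (B (k + 1 + 2)) - of Z) -
              ((∑ j ∈ Finset.Icc 2 (k + 1 + 2), of (B j)) - of (B (k + 1 + 2))) := by abel
        rw [e]
        exact relations.sub_mem e₁ hs
      · -- off-diagonal monomial: descend one dimension
        push Not at hconst
        obtain ⟨i, hi⟩ := hconst
        have hdesc : ∃ (P₁ : MvPolynomial (Fin (k + 2)) ℚ) (N₁ : IntegralRep (k + 2)),
            N₁.domain = {x | ∀ i, x i ∈ Set.Ioo (0:ℝ) 1} ∧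
            EqOn N₁.integrand (fun x => (MvPolynomial.aeval x P₁ : ℝ) / (1 - ∏ i, x i)) N₁.domain ∧
            of N - of N₁ ∈ relations := by
          rcases lt_or_gt_of_ne hi with h | h
          · exact offDiag_descend s c (i := 0) (j := i) h N hNd hNi'
          · exact offDiag_descend s c (i := i) (j := 0) h N hNd hNi'
        obtain ⟨P₁, N₁, hN₁d, hN₁i, hrel⟩ := hdesc
        obtain ⟨β, q, hβ, h⟩ := ih P₁ N₁ hN₁d hN₁i
        refine ⟨β, q, fun j hj => hβ j (by omega), fun B Z hB hZd hZi => ?_⟩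
        have hB' : ∀ j ∈ Finset.Icc 2 (k + 2), (B j).domain = {x | ∀ i, x i ∈ Set.Ioo (0:ℝ) 1} ∧
            EqOn (B j).integrand (fun x => (β j : ℝ) / (1 - ∏ i, x i)) (B j).domain :=
          fun j hj => hB j (Finset.Icc_subset_Icc_right (by omega) hj)
        have e₁ := h B Z hB' hZd hZi
        have e₂ := sum_carriers_mono (by omega : k + 2 ≤ k + 1 + 2) B hB hβ
        have e : of N - (∑ j ∈ Finset.Icc 2 (k + 1 + 2), of (B j)) - of Z =
            (of N - of N₁) + (of N₁ - (∑ j ∈ Finset.Icc 2 (k + 2), of (B j)) - of Z) -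
              ((∑ j ∈ Finset.Icc 2 (k + 1 + 2), of (B j)) - ∑ j ∈ Finset.Icc 2 (k + 2), of (B j)) := by
          abel
        rw [e]
        exact relations.sub_mem (relations.add_mem hrel e₁) e₂
    | add P Q ihP ihQ =>
      intro N hNd hNi
      obtain ⟨NP, hNPd, hNPi⟩ := exists_levelOneRep_dim (by omega : 2 ≤ k + 1 + 2) P
      obtain ⟨NQ, hNQd, hNQi⟩ := exists_levelOneRep_dim (by omega : 2 ≤ k + 1 + 2) Q
      obtain ⟨β₁, q₁, hβ₁, h₁⟩ := ihP NP hNPd (by rw [hNPi]; exact fun _ _ => rfl)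
      obtain ⟨β₂, q₂, hβ₂, h₂⟩ := ihQ NQ hNQd (by rw [hNQi]; exact fun _ _ => rfl)
      refine ⟨β₁ + β₂, q₁ + q₂, fun j hj => by simp [hβ₁ j hj, hβ₂ j hj],
        fun B Z hB hZd hZi => ?_⟩
      have hsplit : of N - of NP - of NQ ∈ relations := by
        refine integrandAddRel_subset_relations ⟨k + 1 + 2, N, NP, NQ, hNPd.trans hNd.symm,
          hNQd.trans hNd.symm, fun x hx => ?_, rfl⟩
        rw [Pi.add_apply, hNi hx, hNPi, hNQi]
        simp only [map_add]
        ring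
      obtain ⟨B₁, hB₁⟩ := exists_zetaCarriers β₁
      obtain ⟨B₂, hB₂⟩ := exists_zetaCarriers β₂
      obtain ⟨Zf, hZf⟩ := exists_ptCarrier
      have e₁ := h₁ B₁ (Zf q₁) (fun j hj => hB₁ j (Finset.mem_Icc.1 hj).1) (hZf q₁).1 (hZf q₁).2
      have e₂ := h₂ B₂ (Zf q₂) (fun j hj => hB₂ j (Finset.mem_Icc.1 hj).1) (hZf q₂).1 (hZf q₂).2
      have eB := sum_carriers_add (d := k + 1 + 2) B B₁ B₂
        (fun j hj => ⟨(hB j hj).1, by simpa only [Pi.add_apply] using (hB j hj).2⟩)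
        (fun j hj => hB₁ j (Finset.mem_Icc.1 hj).1) (fun j hj => hB₂ j (Finset.mem_Icc.1 hj).1)
      have eZ := pt_add_mem_relations Z (Zf q₁) (Zf q₂) hZd (hZf q₁).1 (hZf q₂).1
        (by rw [hZi]; push_cast; rfl) (hZf q₁).2 (hZf q₂).2
      have e : of N - (∑ j ∈ Finset.Icc 2 (k + 1 + 2), of (B j)) - of Z =
          (of N - of NP - of NQ) +
          (of NP - (∑ j ∈ Finset.Icc 2 (k + 1 + 2), of (B₁ j)) - of (Zf q₁)) +
          (of NQ - (∑ j ∈ Finset.Icc 2 (k + 1 + 2), of (B₂ j)) - of (Zf q₂)) -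
          ((∑ j ∈ Finset.Icc 2 (k + 1 + 2), of (B j)) - (∑ j ∈ Finset.Icc 2 (k + 1 + 2), of (B₁ j)) -
            ∑ j ∈ Finset.Icc 2 (k + 1 + 2), of (B₂ j)) -
          (of Z - of (Zf q₁) - of (Zf q₂)) := by abel
      rw [e]
      exact relations.sub_mem (relations.sub_mem (relations.add_mem (relations.add_mem hsplit e₁) e₂)
        eB) eZ

/-- **Values on the tower**: a normal form `Σ_{2≤j≤d} [B j] + [pt, q]` of `c` gives
`eval c = Σ_{2≤j≤d} β_j ζ(j) + q`. [cite: KontsevichZagier2001, §1.1] -/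
theorem tower_value {d : ℕ} {c : FormalRep} {β : ℕ → ℚ} {q : ℚ}
    (h : ∀ (B : (j : ℕ) → IntegralRep j) (Z : IntegralRep 0),
        (∀ j ∈ Finset.Icc 2 d, (B j).domain = {x | ∀ i, x i ∈ Set.Ioo (0:ℝ) 1} ∧
          EqOn (B j).integrand (fun x => (β j : ℝ) / (1 - ∏ i, x i)) (B j).domain) →
        Z.domain = Set.univ → (Z.integrand = fun _ => (q : ℝ)) →
        c - (∑ j ∈ Finset.Icc 2 d, of (B j)) - of Z ∈ relations) :
    eval c = (∑ j ∈ Finset.Icc 2 d, (β j : ℝ) * zetaValue j) + q := by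
  obtain ⟨B, hB⟩ := exists_zetaCarriers β
  obtain ⟨Zf, hZf⟩ := exists_ptCarrier
  have hB' : ∀ j ∈ Finset.Icc 2 d, (B j).domain = {x | ∀ i, x i ∈ Set.Ioo (0:ℝ) 1} ∧
      EqOn (B j).integrand (fun x => (β j : ℝ) / (1 - ∏ i, x i)) (B j).domain :=
    fun j hj => hB j (Finset.mem_Icc.1 hj).1
  have h0 := relations_le_ker_eval_holds (h B (Zf q) hB' (hZf q).1 (hZf q).2)
  rw [AddMonoidHom.mem_ker, map_sub, map_sub, eval_sum_carriers B hB', eval_of,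
    value_pt (Zf q) (hZf q).1 (hZf q).2] at h0
  linarith

/-- **Monotonicity of normal forms in the height** (`β` vanishing above `d`, `d ≤ d'`).
[cite: KontsevichZagier2001, §1.2 rule (1)] -/
theorem tower_normalForm_mono {d d' : ℕ} (hdd' : d ≤ d') {c : FormalRep} {β : ℕ → ℚ} {q : ℚ}
    (hβ : ∀ j, d < j → β j = 0)
    (h : ∀ (B : (j : ℕ) → IntegralRep j) (Z : IntegralRep 0),
        (∀ j ∈ Finset.Icc 2 d, (B j).domain = {x | ∀ i, x i ∈ Set.Ioo (0:ℝ) 1} ∧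
          EqOn (B j).integrand (fun x => (β j : ℝ) / (1 - ∏ i, x i)) (B j).domain) →
        Z.domain = Set.univ → (Z.integrand = fun _ => (q : ℝ)) →
        c - (∑ j ∈ Finset.Icc 2 d, of (B j)) - of Z ∈ relations) :
    ∀ (B : (j : ℕ) → IntegralRep j) (Z : IntegralRep 0),
        (∀ j ∈ Finset.Icc 2 d', (B j).domain = {x | ∀ i, x i ∈ Set.Ioo (0:ℝ) 1} ∧
          EqOn (B j).integrand (fun x => (β j : ℝ) / (1 - ∏ i, x i)) (B j).domain) →
        Z.domain = Set.univ → (Z.integrand = fun _ => (q : ℝ)) →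
        c - (∑ j ∈ Finset.Icc 2 d', of (B j)) - of Z ∈ relations := by
  intro B Z hB hZd hZi
  have e₁ := h B Z (fun j hj => hB j (Finset.Icc_subset_Icc_right hdd' hj)) hZd hZi
  have e₂ := sum_carriers_mono hdd' B hB hβ
  have e : c - (∑ j ∈ Finset.Icc 2 d', of (B j)) - of Z =
      (c - (∑ j ∈ Finset.Icc 2 d, of (B j)) - of Z) -
        ((∑ j ∈ Finset.Icc 2 d', of (B j)) - ∑ j ∈ Finset.Icc 2 d, of (B j)) := by abel
  rw [e]
  exact relations.sub_mem e₁ e₂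

end Summit.KontsevichZagierPeriods.HurwitzMicroSectors.NormalFormPrinciple.PiBox.LevelOne
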